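import Literature.MathematicalPhysics.QuantumManyBody.NeumannSymmetrization
import HarnessLib

/-!
# The symmetrisation `f^s` as the full lattice sum over `ℤ³`

Topic `Literature/MathematicalPhysics/QuantumManyBody`, namespace `NeumannBox` (provefact
`Literature.MathematicalPhysics.QuantumManyBody.BoseGas.Junge2026_neumannBox_pinnedLowerBound`; companion
of `NeumannSymmetrization.lean`). [FournaisEtAl2024, (2.21)] define `f^s(x,y) = Σ_{z∈ℤ³} f(p_z(x) - y)`
for `x, y ∈ Λ`, noting that "since `supp g ⊂ B(0,R)`, the sum defining `g^s` is finite";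
`symmetrize ℓ f x y` sums over `z ∈ {-1,0,1}³` only. Here we prove that this loses nothing: for
`x, y ∈ Λ = [0,ℓ)³` and `f` vanishing outside the ball of radius `R < ℓ`, every term with
`z ∉ {-1,0,1}³` vanishes (`apply_mirror_sub_eq_zero`), so `symmetrize ℓ f x y` is the sum over any
finite set of images containing `{-1,0,1}³` (`symmetrize_eq_sum`) and the unconditional sum over
all of `ℤ³` (`symmetrize_eq_tsum`).

## References

* [FournaisEtAl2024] S. Fournais et al., arXiv:2408.14222: §2.5, (2.19), (2.21) and the sentence
  following (2.30) ("the sum defining `g^s` is finite").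
-/

noncomputable section

open Real MeasureTheory Set Finset
open scoped BigOperators

namespace Literature.MathematicalPhysics.QuantumManyBody.NeumannBox

open Literature.MathematicalPhysics.QuantumManyBody.BoseGas

variable {ℓ : ℝ}

/-- The one-dimensional mirror maps `[0, ℓ)` into `[ℓz, ℓz + ℓ]`. [cite: FournaisEtAl2024, (2.19) ("p_z(Λ) = Λ + ℓz")] -/
theorem mirror₁_mem_Icc (z : ℤ) {t : ℝ} (ht : t ∈ Ico 0 ℓ) :
    mirror₁ ℓ z t ∈ Icc (ℓ * z) (ℓ * z + ℓ) := by
  have hs : |((-1 : ℝ) ^ z) * (t - ℓ / 2)| ≤ ℓ / 2 := by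
    rw [abs_mul, abs_neg_one_zpow, one_mul, abs_le]
    constructor <;> linarith [ht.1, ht.2]
  rw [abs_le] at hs
  unfold mirror₁
  constructor <;> linarith [hs.1, hs.2]

/-- **Only the near images meet the potential**: for `x, y ∈ Λ`, `supp f ⊆ B̄(0,R)` with `R < ℓ`
and `z ∉ {-1,0,1}³`, `f(p_z(x) - y) = 0`. [cite: FournaisEtAl2024, §2.5 (after (2.30): "the sum defining g^s is finite")] -/
theorem apply_mirror_sub_eq_zero (hℓ : 0 < ℓ) {f : Space → ℝ} {R : ℝ} (hsupp : ∀ w, R < ‖w‖ → f w = 0)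
    (hR : R < ℓ) {x y : Space} (hx : x ∈ cell ℓ) (hy : y ∈ cell ℓ) {z : Fin 3 → ℤ}
    (hz : z ∉ nearImages) : f (mirror ℓ z x - y) = 0 := by
  -- a coordinate with `|zᵢ| ≥ 2`
  obtain ⟨i, hi⟩ : ∃ i, z i ∉ Finset.Icc (-1 : ℤ) 1 := by
    by_contra h
    push Not at h
    exact hz (Fintype.mem_piFinset.2 h)
  rw [Finset.mem_Icc, not_and_or, not_le, not_le] at hi
  refine hsupp _ (lt_of_lt_of_le hR ?_)
  -- `|(p_z x - y)ᵢ| ≥ ℓ`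
  have hcoord : ℓ ≤ |(mirror ℓ z x - y) i| := by
    rw [PiLp.sub_apply, mirror_apply]
    obtain ⟨h1, h2⟩ := mirror₁_mem_Icc (z i) (hx i)
    obtain ⟨hy1, hy2⟩ := hy i
    rcases hi with h | h
    · have hz2 : (z i : ℝ) ≤ -2 := by exact_mod_cast (show z i ≤ -2 by omega)
      rw [abs_of_nonpos (by nlinarith)]
      nlinarith
    · have hz2 : (2 : ℝ) ≤ z i := by exact_mod_cast (show (2 : ℤ) ≤ z i by omega)
      rw [abs_of_nonneg (by nlinarith)]
      nlinarith
  calc ℓ ≤ |(mirror ℓ z x - y) i| := hcoord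
    _ = ‖(mirror ℓ z x - y) i‖ := (Real.norm_eq_abs _).symm
    _ ≤ ‖mirror ℓ z x - y‖ := PiLp.norm_apply_le _ i

/-- **`f^s` over any finite set of images containing `{-1,0,1}³`.**
[cite: FournaisEtAl2024, (2.21)] -/
theorem symmetrize_eq_sum (hℓ : 0 < ℓ) {f : Space → ℝ} {R : ℝ} (hsupp : ∀ w, R < ‖w‖ → f w = 0)
    (hR : R < ℓ) {x y : Space} (hx : x ∈ cell ℓ) (hy : y ∈ cell ℓ) {Z : Finset (Fin 3 → ℤ)}
    (hZ : nearImages ⊆ Z) : symmetrize ℓ f x y = ∑ z ∈ Z, f (mirror ℓ z x - y) := by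
  rw [symmetrize]
  exact (Finset.sum_subset hZ fun z _ hz => apply_mirror_sub_eq_zero hℓ hsupp hR hx hy hz)

/-- **`f^s(x,y) = Σ_{z∈ℤ³} f(p_z(x) - y)`** as printed, for `x, y ∈ Λ` and `supp f ⊆ B̄(0,R)`,
`R < ℓ`. [cite: FournaisEtAl2024, (2.21)] -/
theorem symmetrize_eq_tsum (hℓ : 0 < ℓ) {f : Space → ℝ} {R : ℝ} (hsupp : ∀ w, R < ‖w‖ → f w = 0)
    (hR : R < ℓ) {x y : Space} (hx : x ∈ cell ℓ) (hy : y ∈ cell ℓ) :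
    symmetrize ℓ f x y = ∑' z : Fin 3 → ℤ, f (mirror ℓ z x - y) := by
  rw [tsum_eq_sum (s := nearImages) fun z hz => apply_mirror_sub_eq_zero hℓ hsupp hR hx hy hz, symmetrize]

end Literature.MathematicalPhysics.QuantumManyBody.NeumannBox
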